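import Summits.QuantumFields.QCD.Theses.TransparentRPWall
import Summits.QuantumFields.YangMills.Theorems.MirrorModularBoostsCurvatureBoostCovarianceRegularOfDominated
import Literature.MathematicalPhysics.QuantumFieldTheory.OSLorentzInvariance

/-!
# Birth skeleton — crux `TransparentRPWall.QCDSieveInputs` (stmt-QuantumFields-18042)

Piece 1 of the crux-strategist split of `QCDBoostCovariance` (stmt-QuantumFields-9909, route
`route-QuantumFields-TransparentRPWall`, sub `QCD`; planner-cstrat-stmt-QuantumFields-9909-r1-0, 2026-08-17):
WHAT THE LATTICE TIE MUST SUPPLY TO THE SIEVE — for every `N_f`, lattice-QCD scheme `sch` and labelled family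
`S` over `QCDField N_f` with the package `W` of `QCDBoostCovariance`, the eight planar frames and the cone:
(i) STEP 0, every species string `𝔖ₙᵏ|⁰𝒮` is integration against a function; (ii) LEVEL GROWTH, at every OS
level `a`, given planar invariance of all strings of degree `≤ 2a − 2`, the diagonal doubled pencil of a
degree-`a` string with trigonometric orbit function `Σ p_j e^{4ijθ}` has no layer `|j| ≥ 2`.

The labelled twin of the TWO places where the lattice enters the sibling one-species line
`YangMills/Cruxes/CurvatureBoostCovariance/Lines/boosts_inherit_mirrors.lean` (crux 9663): its reshape-8 Step 0
(`stub_temperedLatticeApproximants` + `stub_dominatedTieLimit` + `stub_regular_of_dominated` + E0) and its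
level growth (`stub_levelGrowthLow` from `CurvatureKernelBound` + landed `KernelTransfer` + proved
`ShellRigidity`; `stub_levelGrowthHigh` THE BET).  Stubs (5 registered `sorry`s + 1 landed theorem by name):

* `stub_temperedLatticeApproximantsQCD` — (i)'s QCD INPUT, per label string: complex lattice densities on the
                                scheme's tori, TEMPERED at injective multi-sites uniformly in `k`, whose Riemann
                                sums converge to `𝔖ₙᵏ` on off-diagonal real tensors.       XL (UV property of the limit)
* `stub_dominatedTieLimitC`   — the COMPLEX twin of the LANDED `stub_dominatedTieLimit` (p108509): tempered
                                approximants tied to `T` on real tensors ⇒ `‖T F‖ ≤ ∫ ‖F‖ w` on `⁰𝒮`.  M–L, provable now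
* (landed, by name) `BoostsInheritMirrors.stub_regular_of_dominated` (p109000): domination ⇒ a function.
* `stub_speciesKernelBoundQCD` — (ii) at level 1, its QCD INPUT: every DIAGONAL two-point function
                                `𝔖₂^{(s,s)}|⁰𝒮` is a kernel continuous off `0` with `|K_s(x)| ≤ C(1+‖x‖^{η−10})`
                                (the QCD twin of `PencilRigidity.CurvatureKernelBound`, item 11687, for every
                                species of dimension `< 5`).                                L–XL (two-point UV bound)
* `stub_levelGrowthLowL_of_kernel` — (ii) at levels `a ≤ 1` from the kernel triples, MODEL-BLIND (restrict to the
                                constant label string `(s,s)`: the landed one-species `KernelTransfer.kernelTransfer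
                                _proof` + `ShellRigidity_proof` make `K_s` radial, so the degree-2 orbit is constant and
                                `trigPoly_coeff_eq_zero_of_const` (landed) kills its non-zero layers).   M, provable now
* `stub_levelGrowthHighQCD`   — (ii) at levels `a ≥ 2`: THE BET (light-cone / dyadic-in-energy growth of doubled
                                composite correlators along an asymptotically free scheme; no engine). XL (hardest)

`QCDSieveInputs_of` composes them into the crux BY NAME (degree `0` of (i) is E0, proved here; the tempered
weight's measurability / continuity off the coincidence locus is proved here, verbatim the sibling's).
`lean check`: sorries ONLY in the five `stub_*`.
-/

noncomputable section

attribute [-instance] SimplexCategory.instFintypeToTypeOrderHomFinHAddNatLenOfNat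

namespace Summit.QuantumFields.QCD.Cruxes.QCDSieveInputs.Birth

open scoped BigOperators SchwartzMap
open MeasureTheory Filter Topology
open Literature.MathematicalPhysics.QuantumLattice Literature.MathematicalPhysics.AQFT
  Literature.MathematicalPhysics.QuantumFieldTheory
open Literature.Probability.LatticeModels (Site box)

/-- Euclidean `ℝ⁴`. -/
abbrev E4 : Type := EuclideanSpace ℝ (Fin 4)

/-! ## The labelled predicates (verbatim the clauses of the route decls, `E4` for `E`) -/

section Preds

variable {ι : Type}

/-- Reflection positivity in pull-back form for the EIGHT planar frames. -/
def Frames8 (S : LabelledSchwingerFamily ι E4) : Prop :=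
  ∀ (R : E4 ≃ₗᵢ[ℝ] E4) (a b : ℝ), a ^ 2 + b ^ 2 = 1 → (a = 0 ∨ b = 0 ∨ a ^ 2 = b ^ 2) →
    R (EuclideanSpace.single 0 1) = a • EuclideanSpace.single 0 1 + b • EuclideanSpace.single 1 1 →
      LabelledSchwingerFamily.IsReflectionPositive (fun n (k : Fin n → ι) => (S n k).comp (linActMulti R))

/-- The labelled planar spectral cone at `S`. -/
def ConeL (S : LabelledSchwingerFamily ι E4) : Prop :=
  ∀ (n m : ℕ) (k : Fin n → ι) (k' : Fin m → ι) (F : SchwartzMap (Fin n → E4) ℂ)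
    (G : SchwartzMap (Fin m → E4) ℂ), IsTimeOrdered F → IsTimeOrdered G → ∃ Φ : ℂ × ℂ → ℂ,
    DifferentiableOn ℂ Φ {w : ℂ × ℂ | |w.2.im| < w.1.re} ∧ (∀ (t b : ℝ), 0 < t → ∀ H : SchwartzMap
    (Fin (n + m) → E4) ℂ, IsAppendTensorOf H (osAdjoint F) (translateMulti (t • EuclideanSpace.single 0 1
    + b • EuclideanSpace.single 1 1) G) → Φ ((t : ℂ), (b : ℂ)) = S (n + m) (Fin.append (k ∘ Fin.rev) k')
    H) ∧ (∀ w ∈ {w : ℂ × ℂ | |w.2.im| < w.1.re}, ∀ (HF : SchwartzMap (Fin (n + n) → E4) ℂ) (HG :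
    SchwartzMap (Fin (m + m) → E4) ℂ), IsAppendTensorOf HF (osAdjoint F) F → IsAppendTensorOf HG
    (osAdjoint G) G → ‖Φ w‖ ^ 2 ≤ ‖S (n + n) (Fin.append (k ∘ Fin.rev) k) HF‖ * ‖S (m + m) (Fin.append
    (k' ∘ Fin.rev) k') HG‖)

/-- Invariance on `⁰𝒮` under the proper signed permutations. -/
def HypL (S : LabelledSchwingerFamily ι E4) : Prop :=
  ∀ (n : ℕ) (k : Fin n → ι) (R : E4 ≃ₗᵢ[ℝ] E4), LinearMap.det (R.toLinearEquiv : E4 →ₗ[ℝ] E4) = 1 →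
    (∀ i : Fin 4, ∃ j : Fin 4, R (EuclideanSpace.single i 1) = EuclideanSpace.single j 1 ∨
      R (EuclideanSpace.single i 1) = -EuclideanSpace.single j 1) →
    ∀ F : SchwartzMap (Fin n → E4) ℂ, IsOffDiagonal F → S n k (linActMulti R F) = S n k F

/-- The Step-0 function residual, labelled. -/
def RegL (S : LabelledSchwingerFamily ι E4) : Prop :=
  ∀ (n : ℕ) (k : Fin n → ι), ∃ Wf : (Fin n → E4) → ℂ, ∀ F : SchwartzMap (Fin n → E4) ℂ, IsOffDiagonal F →
    MeasureTheory.Integrable (fun x : Fin n → E4 => Wf x * F x) ∧ S n k F = ∫ x : Fin n → E4, Wf x * F x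

/-- Planar-rotation invariance of all strings of degree `N`. -/
def PInvAt (S : LabelledSchwingerFamily ι E4) (N : ℕ) : Prop :=
  ∀ R : E4 ≃ₗᵢ[ℝ] E4, LinearMap.det (R.toLinearEquiv : E4 →ₗ[ℝ] E4) = 1 → R (EuclideanSpace.single 2 1)
    = EuclideanSpace.single 2 1 → R (EuclideanSpace.single 3 1) = EuclideanSpace.single 3 1 →
    ∀ (k : Fin N → ι) (F : SchwartzMap (Fin N → E4) ℂ), IsOffDiagonal F → S N k (linActMulti R F) = S N k F

/-- The level-`a` growth clause (no layer `|j| ≥ 2` in the diagonal doubled pencils of degree-`a` strings). -/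
def GrowAt (S : LabelledSchwingerFamily ι E4) (a : ℕ) : Prop :=
  ∀ (k : Fin a → ι) (F : SchwartzMap (Fin a → E4) ℂ), IsTimeOrdered F →
    HasCompactSupport (F : (Fin a → E4) → ℂ) → ∀ H : SchwartzMap (Fin (a + a) → E4) ℂ,
    IsAppendTensorOf H (osAdjoint F) F → ∀ (K : ℕ) (p : ℤ → ℂ), (∀ θ : ℝ, S (a + a) (Fin.append (k ∘ Fin.rev) k)
    (linActMulti (planeRot (0 : Fin 3) θ) H) = ∑ j ∈ Finset.Icc (-(K : ℤ)) K, p j * Complex.exp (4 * (j : ℂ)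
    * (θ : ℂ) * Complex.I)) → ∀ j ∈ Finset.Icc (-(K : ℤ)) K, 2 ≤ |j| → p j = 0

/-- The level growth, labelled (all levels, each conditional on invariance in degrees `≤ 2a − 2`). -/
def GrowL (S : LabelledSchwingerFamily ι E4) : Prop :=
  ∀ a : ℕ, (∀ N : ℕ, N + 2 ≤ 2 * a → PInvAt S N) → GrowAt S a

/-- The KERNEL TRIPLE of the diagonal two-point function of species `s`: a real kernel, continuous off `0`,
`|K x| ≤ C (1 + ‖x‖^(η−10))`, representing `𝔖₂^{(s,s)}` on `⁰𝒮`. -/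
def KernelTriple (S : LabelledSchwingerFamily ι E4) (s : ι) : Prop :=
  ∃ (K : E4 → ℝ) (C η : ℝ), 0 < η ∧ ContinuousOn K {x : E4 | x ≠ 0} ∧
    (∀ x : E4, x ≠ 0 → |K x| ≤ C * (1 + ‖x‖ ^ (η - 10))) ∧
    ∀ F : 𝓢((Fin 2 → E4), ℂ), IsOffDiagonal F →
      Integrable (fun x : Fin 2 → E4 => (K (x 0 - x 1) : ℂ) * F x) ∧
        S 2 (fun _ => s) F = ∫ x : Fin 2 → E4, (K (x 0 - x 1) : ℂ) * F x

end Preds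

/-- The package `W` of the crux `QCDBoostCovariance` (verbatim its `let W`, `E4` for `E`). -/
def Wpkg (Nf : ℕ) (sch : QCDScheme Nf) (S : LabelledSchwingerFamily (QCDField Nf) E4) : Prop :=
  ((S.IsNormalized ∧ S.IsHermitian ∧ S.HasLinearGrowth ∧ S.IsReflectionPositive ∧ S.IsSymmetric ∧
  S.HasClusterProperty ∧ (∀ (n : ℕ) (k : Fin n → QCDField Nf) (a : E4) (F : SchwartzMap (Fin n → E4) ℂ),
  IsOffDiagonal F → S n k (translateMulti a F) = S n k F) ∧ (∀ (n : ℕ) (k : Fin n → QCDField Nf)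
  (R : E4 ≃ₗᵢ[ℝ] E4), LinearMap.det (R.toLinearEquiv : E4 →ₗ[ℝ] E4) = 1 → (∀ i : Fin 4, ∃ j : Fin 4, R
  (EuclideanSpace.single i 1) = EuclideanSpace.single j 1 ∨ R (EuclideanSpace.single i 1) =
  -EuclideanSpace.single j 1) → ∀ F : SchwartzMap (Fin n → E4) ℂ, IsOffDiagonal F → S n k (linActMulti
  R F) = S n k F)) ∧ (sch.HasAsymptoticScaling ∧ (∀ fl : Fin Nf, ∀ᶠ k in Filter.atTop, -1 < sch.mq fl
  k) ∧ (∀ (n : ℕ), n ≠ 0 → ∀ (σ : Fin n → QCDField Nf) (f : Fin n → SchwartzMap E4 ℝ) (F : SchwartzMap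
  (Fin n → E4) ℂ), IsTensorOf F (fun i => ofRealTest (f i)) → IsOffDiagonal F → Filter.Tendsto (fun k :
  ℕ => qcdLatticeSchwinger sch k n σ f) Filter.atTop (nhds (S n σ F)))) ∧ (∃ Δ : ℝ, 0 < Δ ∧
  S.HasMassGap Δ ∧ sch.HasLatticeMassGap Δ))

/-- **The crux, unbundled** (definitional). -/
theorem inputs_iff :
    Summit.QuantumFields.QCD.Theses.TransparentRPWall.QCDSieveInputs ↔
      ∀ (Nf : ℕ) (sch : QCDScheme Nf) (S : LabelledSchwingerFamily (QCDField Nf) E4),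
        Wpkg Nf sch S → Frames8 S → ConeL S → RegL S ∧ GrowL S :=
  Iff.rfl

/-! ## The stubs -/

/-- **Stub 1a — TEMPERED LATTICE APPROXIMANTS: the QCD input of Step 0 (USES THE TIE; difficulty XL = a UV
property of the Wilson-QCD limit, the `n`-point soft-exponent analogue of a two-point kernel bound; labelled
twin of the sibling's reshape-8 Stub 1a).**  For every `N_f`, `sch`, `S` with the package, the eight frames and
the cone, every degree `n ≥ 1` and every species string `k`: there are COMPLEX lattice densities
`D_j : (Site 4)ⁿ → ℂ` on the scheme's tori, TEMPERED at injective multi-sites uniformly in `j ≥ j₀` —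
`‖D_j(x)‖ ≤ C (1 + ‖a_j x‖)^N (1 + Σ_{i ≠ i'} ‖a_j xᵢ − a_j xᵢ'‖⁻¹)^N` — whose Riemann sums converge to `S n k`
on every off-diagonal real tensor `f₁ ⊗ ⋯ ⊗ fₙ ∈ ⁰𝒮`.  INTENDED WITNESS: the true renormalised moment densities
`D_j(x) = ∏ᵢ z_{kᵢ}(j) · ⟨∏ᵢ (O_{kᵢ}(xᵢ) − shift_{kᵢ}(j))⟩_j` of the composite fields (Wilson action density /
hermitian pseudoscalar bilinears; Grassmann × Haar expectation at step `j`), for which the convergence clause IS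
the tie of `W` (after expanding `qcdLatticeSchwinger` over multi-sites — non-injective multi-sites do not see
off-diagonal tensors) and the bound is UV TEMPEREDNESS of the renormalised composite moments at non-coinciding
points ("every species has a scaling dimension"; every perturbative / OPE expectation).  WHY `∃ D`: `W` pins
neither the species renormalisations `z_s` nor non-triviality, so only the limit-side content is asserted (junk
schemes have the witness `D ≡ 0` or `κⁿ`-type constants).  Frames and cone are idle (kept so the statement is
WEAKER than a `W`-only version).  Junk families (`𝔖₄ = J`) violate it. -/
theorem stub_temperedLatticeApproximantsQCD :
    open Literature.MathematicalPhysics.QuantumLattice Literature.MathematicalPhysics.AQFT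
      Literature.MathematicalPhysics.QuantumFieldTheory Literature.Probability.LatticeModels in
    ∀ (Nf : ℕ) (sch : QCDScheme Nf) (S : LabelledSchwingerFamily (QCDField Nf) E4),
      Wpkg Nf sch S → Frames8 S → ConeL S →
      ∀ n : ℕ, 0 < n → ∀ k : Fin n → QCDField Nf,
        ∃ (D : ℕ → (Fin n → Site 4) → ℂ) (C : ℝ) (N j₀ : ℕ), 0 < C ∧
          (∀ j : ℕ, j₀ ≤ j → ∀ x : Fin n → Site 4, (∀ i, x i ∈ box 4 (sch.L j)) → Function.Injective x →
            ‖D j x‖ ≤ C * (1 + ‖fun i => sch.a j • siteToE (x i)‖) ^ N *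
              (1 + ∑ i, ∑ i' ∈ Finset.univ.erase i,
                ‖sch.a j • siteToE (x i) - sch.a j • siteToE (x i')‖⁻¹) ^ N) ∧
          ∀ (f : Fin n → SchwartzMap E4 ℝ) (F : SchwartzMap (Fin n → E4) ℂ),
            IsTensorOf F (fun i => ofRealTest (f i)) → IsOffDiagonal F →
            Filter.Tendsto (fun j => ((sch.a j ^ 4) ^ n : ℂ) *
              ∑ x ∈ Fintype.piFinset (fun _ : Fin n => box 4 (sch.L j)),
                (∏ i, (f i (sch.a j • siteToE (x i)) : ℂ)) * D j x) Filter.atTop (nhds (S n k F)) := by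
  sorry

/-- **Stub 1b — THE DOMINATED TIE LIMIT, complex densities (model-blind real analysis; difficulty M–L; PROVABLE
NOW: the COMPLEX twin of the LANDED `BoostsInheritMirrors.stub_dominatedTieLimit`,
`Theorems/MirrorModularBoostsCurvatureBoostCovarianceDominatedTieLimit.lean`, p108509 — same proof with `‖·‖`
for `|·|`).**  `T` a continuous linear functional on `𝓢((ℝ⁴)ⁿ, ℂ)`, `n ≥ 1`; `a_j > 0`, `a_j → 0`, `a_j L_j → ∞`;
`D_j : (ℤ⁴)ⁿ → ℂ` and a weight `w ≥ 0`, measurable, continuous off the coincidence locus and tempered there,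
with `‖D_j(x)‖ ≤ w(a_j x)` at injective multi-sites of the box for `j ≥ j₀`.  IF the Riemann sums
`Λ_j(F) = (a_j⁴)ⁿ Σ_{x ∈ boxⁿ} F(a_j x) D_j(x)` converge to `T F` on every off-diagonal real tensor, THEN for every
`F ∈ ⁰𝒮`: `‖F‖·w ∈ L¹` and `‖T F‖ ≤ ∫ ‖F‖ w` (equicontinuity of `Λ_j` on `⁰𝒮` from weighted flatness at the
coincidence locus + density of off-diagonal real tensors + Riemann sums of the continuous integrand `‖F‖ w`). -/
theorem stub_dominatedTieLimitC :
    open Literature.MathematicalPhysics.QuantumLattice Literature.MathematicalPhysics.AQFT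
      Literature.Probability.LatticeModels in
    ∀ (n : ℕ), 0 < n → ∀ (T : SchwartzMap (Fin n → E4) ℂ →L[ℂ] ℂ) (a : ℕ → ℝ) (L : ℕ → ℕ)
      (D : ℕ → (Fin n → Site 4) → ℂ) (w : (Fin n → E4) → ℝ) (C : ℝ) (N j₀ : ℕ),
      (∀ j, 0 < a j) → Filter.Tendsto a Filter.atTop (nhds 0) →
      Filter.Tendsto (fun j => a j * L j) Filter.atTop Filter.atTop →
      Measurable w → ContinuousOn w (coincidenceLocus n E4)ᶜ → (∀ y, 0 ≤ w y) →
      (∀ y ∉ coincidenceLocus n E4,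
        w y ≤ C * (1 + ‖y‖) ^ N * (1 + ∑ i, ∑ i' ∈ Finset.univ.erase i, ‖y i - y i'‖⁻¹) ^ N) →
      (∀ j, j₀ ≤ j → ∀ x : Fin n → Site 4, (∀ i, x i ∈ box 4 (L j)) → Function.Injective x →
        ‖D j x‖ ≤ w (fun i => a j • siteToE (x i))) →
      (∀ (f : Fin n → SchwartzMap E4 ℝ) (F : SchwartzMap (Fin n → E4) ℂ),
        IsTensorOf F (fun i => ofRealTest (f i)) → IsOffDiagonal F →
        Filter.Tendsto (fun j => ((a j ^ 4) ^ n : ℂ) * ∑ x ∈ Fintype.piFinset (fun _ : Fin n => box 4 (L j)),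
          (∏ i, (f i (a j • siteToE (x i)) : ℂ)) * D j x) Filter.atTop (nhds (T F))) →
      ∀ F : SchwartzMap (Fin n → E4) ℂ, IsOffDiagonal F →
        MeasureTheory.Integrable (fun y : Fin n → E4 => ‖F y‖ * w y) ∧ ‖T F‖ ≤ ∫ y : Fin n → E4, ‖F y‖ * w y := by
  sorry

/-- **Stub 2a — THE SPECIES KERNEL BOUND: the QCD input of the level growth at level 1 (USES THE TIE; difficulty
L–XL; the QCD twin of item stmt-QuantumFields-11687 `PencilRigidity.CurvatureKernelBound`, for EVERY species).**
For a family with the package, every DIAGONAL two-point function `𝔖₂^{(s,s)}` is, on `⁰𝒮`, integration against a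
translation-invariant real kernel `K_s(x₀ − x₁)`, continuous on `ℝ⁴ ∖ 0`, with `|K_s(x)| ≤ C (1 + ‖x‖^(η−10))`
for some `η > 0` — "the composite field `s` has ultraviolet dimension `< 5`": expected `|x|^{-8}` for the glue
channel (dimension 4; its `ψ̄ψ` admixture is softer), `|x|^{-6}` for the pseudoscalar bilinears (dimension 3);
the infrared side is the gap.  Translation invariance and reality come from `W` (translations, hermiticity +
E3); continuity off `0` and the power bound are the UV content (a piece of the existence problem, as 11687). -/
theorem stub_speciesKernelBoundQCD :
    open Literature.MathematicalPhysics.QuantumLattice Literature.MathematicalPhysics.AQFT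
      Literature.MathematicalPhysics.QuantumFieldTheory in
    ∀ (Nf : ℕ) (sch : QCDScheme Nf) (S : LabelledSchwingerFamily (QCDField Nf) E4),
      Wpkg Nf sch S → Frames8 S → ConeL S → ∀ s : QCDField Nf, KernelTriple S s := by
  sorry

/-- **Stub 2b — LEVEL GROWTH AT LEVELS `a ≤ 1` FROM THE KERNEL TRIPLES (model-blind; difficulty M; PROVABLE NOW —
the labelled port of the sibling's `levelGrowthLow_of_kernel`).**  For a labelled family with E3, proper
hypercubic invariance on `⁰𝒮`, the eight frames and a kernel triple for every species: at `a = 0` the orbit is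
constant (degree `0`); at `a = 1` the doubled string of `F` (label `k 0 = s`) is the diagonal two-point function
`𝔖₂^{(s,s)}` (`Fin.append (k ∘ Fin.rev) k = fun _ => s` by `funext` + `Fin` cases), whose RESTRICTION to the
constant label is a one-species family `S_s n := S n (fun _ => s)` with `W(B₄)`-invariance (`HypL`) and
axis + diagonal reflection positivity (`Frames8` at constant label strings), so the LANDED
`KernelTransfer.kernelTransfer_proof` + `ShellRigidity_proof` (item 11685, PROVED) make `K_s` radial,
`radialKernel_invariant_two` makes the degree-2 orbit constant, and `trigPoly_coeff_eq_zero_of_const` (landed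
with the sibling's Stub 5a) kills every non-zero layer — in particular `|j| ≥ 2`. -/
theorem stub_levelGrowthLowL_of_kernel :
    ∀ (ι : Type) (S : LabelledSchwingerFamily ι E4), S.IsSymmetric → HypL S → Frames8 S →
      (∀ s : ι, KernelTriple S s) → ∀ a : ℕ, a ≤ 1 → GrowAt S a := by
  sorry

/-- **Stub 2c — LEVEL GROWTH AT LEVELS `a ≥ 2`: THE TRANSFER `C⁺ = G_a`, USES THE TIE — THE BET (difficulty XL,
hardest; labelled twin of the sibling's `stub_levelGrowthHigh`, no engine on record).**  For a family with the
package, the eight frames and the cone, at every level `a ≥ 2`: given planar invariance of all strings of degree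
`≤ 2a − 2`, the diagonal doubled pencil of a compactly supported time-ordered degree-`a` string (labels
`rev k ++ k`) with trigonometric orbit function `Σ p_j e^{4ijθ}` has `p_j = 0` for `|j| ≥ 2` — the boosted norms
`‖Ψ^χ_F‖²` are `o(e^{8|χ|})`: ONE squeezed pair of composite insertions (the mirror-adjacent pair; the outer legs
ride on boosts unitary by the hypothesis) costs at most its dimension `< 5`, softened.  Source on offer:
asymptotic freedom (perturbative UV of the composite-field OPE along the scaling scheme) — the regime where
lattice QCD should be controllable; the marginal layers `j = ±1` are NOT asked (parity kills them in piece 2).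
Not refutable in any controlled scheme (c-number limits: constant orbits); FALSE without the tie (the 16-mirror
anisotropic Gaussian zoo: `p_{±2} ≠ 0` already at `a = 1`), like the crux. -/
theorem stub_levelGrowthHighQCD :
    open Literature.MathematicalPhysics.QuantumLattice Literature.MathematicalPhysics.AQFT
      Literature.MathematicalPhysics.QuantumFieldTheory in
    ∀ (Nf : ℕ) (sch : QCDScheme Nf) (S : LabelledSchwingerFamily (QCDField Nf) E4),
      Wpkg Nf sch S → Frames8 S → ConeL S →
      ∀ a : ℕ, 2 ≤ a → (∀ N : ℕ, N + 2 ≤ 2 * a → PInvAt S N) → GrowAt S a := by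
  sorry

/-! ## Proved here: degree `0` of Step 0, the tempered weight, the composition -/

/-- The Step-0 function residual in degree `0` is E0 (`W₀ ≡ 1`; Lebesgue measure on `Fin 0 → ℝ⁴` is the Dirac
mass) — labelled port of the sibling's `residual_zero`. -/
theorem residual_zero {ι : Type} (S : LabelledSchwingerFamily ι E4) (h0 : S.IsNormalized) (k : Fin 0 → ι) :
    ∃ W : (Fin 0 → E4) → ℂ, ∀ F : 𝓢((Fin 0 → E4), ℂ), IsOffDiagonal F →
      Integrable (fun x : Fin 0 → E4 => W x * F x) ∧ S 0 k F = ∫ x : Fin 0 → E4, W x * F x := by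
  have hvol : (volume : Measure (Fin 0 → E4)) = Measure.dirac default := by
    rw [MeasureTheory.volume_pi]
    exact Measure.pi_of_empty _ default
  refine ⟨fun _ => 1, fun F _ => ?_⟩
  simp only [one_mul]
  refine ⟨?_, ?_⟩
  · rw [hvol]
    exact (integrable_const (F default)).congr (ae_eq_dirac (F : (Fin 0 → E4) → ℂ)).symm
  · rw [hvol, integral_dirac]
    exact (h0 k F).trans (congrArg F (Subsingleton.elim _ _))

/-- **The skeleton**: the five stubs (+ the landed `stub_regular_of_dominated`) prove
`TransparentRPWall.QCDSieveInputs` (concluded BY NAME; the only sorries are the stubs). -/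
theorem QCDSieveInputs_of : Summit.QuantumFields.QCD.Theses.TransparentRPWall.QCDSieveInputs := by
  rw [inputs_iff]
  intro Nf sch S hW h8 hC
  refine ⟨?_, ?_⟩
  · -- (i) Step 0: degree 0 is E0; degree n ≥ 1 from Stubs 1a, 1b and the landed regular-of-dominated
    intro n k
    rcases Nat.eq_zero_or_pos n with rfl | hn
    · exact residual_zero S hW.1.1 k
    obtain ⟨D, C, N, j₀, hCpos, hbound, htie⟩ := stub_temperedLatticeApproximantsQCD Nf sch S hW h8 hC n hn k
    -- the tempered weight of Stub 1a, read on continuum configurations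
    have hcont : ContinuousOn (fun y : Fin n → E4 => C * (1 + ‖y‖) ^ N *
        (1 + ∑ i, ∑ i' ∈ Finset.univ.erase i, ‖y i - y i'‖⁻¹) ^ N) (coincidenceLocus n E4)ᶜ := by
      refine (continuousOn_const.mul ((continuousOn_const.add continuous_norm.continuousOn).pow N)).mul
        ((continuousOn_const.add (continuousOn_finsetSum _ fun i _ =>
          continuousOn_finsetSum _ fun i' hi' => ?_)).pow N)
      have hne : ∀ y ∈ (coincidenceLocus n E4)ᶜ, ‖y i - y i'‖ ≠ 0 := fun y hy h =>
        hy ⟨i, i', (Finset.ne_of_mem_erase hi').symm, sub_eq_zero.1 (norm_eq_zero.1 h)⟩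
      exact ContinuousOn.inv₀ (by fun_prop) hne
    have hmeas : Measurable (fun y : Fin n → E4 => C * (1 + ‖y‖) ^ N *
        (1 + ∑ i, ∑ i' ∈ Finset.univ.erase i, ‖y i - y i'‖⁻¹) ^ N) := by
      fun_prop
    have hnn : ∀ y : Fin n → E4, 0 ≤ C * (1 + ‖y‖) ^ N *
        (1 + ∑ i, ∑ i' ∈ Finset.univ.erase i, ‖y i - y i'‖⁻¹) ^ N := fun y =>
      mul_nonneg (mul_nonneg hCpos.le (by positivity)) (by positivity)
    -- Stub 1b + the landed regular-of-dominated
    exact Summit.QuantumFields.YangMills.Theorems.CurvatureBoostCovariance.BoostsInheritMirrors.stub_regular_of_dominated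
      n (S n k) _ C N hmeas hnn (fun y _ => le_rfl)
      (stub_dominatedTieLimitC n hn (S n k) sch.a sch.L D _ C N j₀ sch.a_pos sch.tendsto_a sch.tendsto_L
        hmeas hcont hnn (fun y _ => le_rfl) hbound htie)
  · -- (ii) the level growth: a ≤ 1 from the kernel triples (Stubs 2a, 2b), a ≥ 2 THE BET (Stub 2c)
    intro a hInv
    by_cases ha : a ≤ 1
    · have hWpkg := hW
      obtain ⟨⟨-, -, -, -, hsymm, -, -, hhyp⟩, -, -⟩ := hW
      exact stub_levelGrowthLowL_of_kernel (QCDField Nf) S hsymm hhyp h8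
        (stub_speciesKernelBoundQCD Nf sch S hWpkg h8 hC) a ha
    · exact stub_levelGrowthHighQCD Nf sch S hW h8 hC a (by omega) hInv

end Summit.QuantumFields.QCD.Cruxes.QCDSieveInputs.Birth

end
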